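import Summits.QuantumFields.YangMills.Theorems.ColdStartUniversalityLatticeLangevinMarkovProperty
import Summits.QuantumFields.YangMills.Theorems.ColdStartUniversalityLatticeLangevinFellerJoint
import HarnessLib

/-!
# Route `ColdStartUniversality` (fixed-cut-off SZZ dynamics): the MARKOV PROPERTY FOR TIME INTEGRALS along a strong solution —
# `E[Z · ∫_(s,s+τ] F(U_r) dr] = E[Z · ∫_(0,τ] (κ_v F)(U_s) dv]`, and adaptedness of path integrals of progressively measurable solutions

Helper file (seat `ym-line-csu-p1`, g34; `--supports stmt-QuantumFields-24809`).  Two pieces of plumbing for the exponential (Hoeffding)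
concentration of time averages of the cold-start Langevin sampler (next file), both about the path integrals `∫_(a,b] F(U_r) dr` of a strong
solution `U` of the SU(2) SZZ dynamics:
* `measurable_clampIic`, `clampIic_coe_of_mem`, ★ `measurable_setIntegral_path` — if the restriction of `U` to `[0,i] × Ω` is measurable for
  `𝓑([0,i]) ⊗ m` (progressive measurability at level `i`, `m` ANY σ-algebra on `Ω`, e.g. `𝓕^W_i`), then `ω ↦ ∫_(a,b] φ(U_r ω) dr` is
  `m`-measurable for `0 ≤ a`, `b ≤ i` and measurable `φ` (clamp `r ↦ r⁺ ∧ i`, `StronglyMeasurable.integral_prod_right`);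
* ★★ `integral_mul_setIntegral_comp_eq_integral_mul_setIntegral_transition` — the Markov property of file 44
  (`integral_mul_comp_add_eq_integral_mul_transition`) integrated in time (Fubini on `Ω × (s, s+τ]`): for every jointly measurable strong
  solution from a deterministic start on ANY space, every realising kernel family `κ`, every bounded `𝓕^W_s`-measurable `Z`, every continuous
  bounded `F` and `τ ≥ 0`, `E[Z · ∫_(s,s+τ] F(U_r) dr] = E[Z · (∫_(0,τ] κ_v F dv)(U_s)]` — the identity that makes
  `u(U_(s+τ)) − u(U_s) + ∫_(s,s+τ] Ĝ(U_r) dr` a martingale increment when `u` is the Poisson corrector of `Ĝ` (`exists_poisson_solution`).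
THEOREMS ONLY, no definition, no sorry; [folklore].  HONEST FRAMING: fixed cut-off; `UniformColdStartMixing` (24809) is NOT restated; no crux,
rung or summit statement is proved; the Yang–Mills mass gap is NOT proved.
-/

set_option autoImplicit false

noncomputable section

namespace Summit.QuantumFields.YangMills.Theorems.ColdStartUniversality

open MeasureTheory ProbabilityTheory Filter Topology Set
open scoped NNReal ENNReal BigOperators
open Literature Literature.Probability.Process Literature.MathematicalPhysics.QuantumFieldTheory
open Literature.MathematicalPhysics.QuantumLattice (fundamentalRep fundamentalLatticeRep continuous_fundamentalRep)

/-! ## §1. Path integrals of progressively measurable processes are adapted -/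

/-- The clamp `r ↦ r⁺ ∧ i ∈ [0, i]` is measurable. [folklore] -/
theorem measurable_clampIic (i : ℝ≥0) :
    Measurable fun r : ℝ => (⟨min r.toNNReal i, Set.mem_Iic.2 (min_le_right _ _)⟩ : Set.Iic i) :=
  (measurable_real_toNNReal.min measurable_const).subtype_mk

/-- On `(a, b] ⊆ [0, i]` the clamp is the identity: `r⁺ ∧ i = r⁺`. [folklore] -/
theorem clampIic_coe_of_mem {i : ℝ≥0} {a b r : ℝ} (ha : 0 ≤ a) (hb : b ≤ (i : ℝ)) (hr : r ∈ Set.Ioc a b) :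
    ((⟨min r.toNNReal i, Set.mem_Iic.2 (min_le_right _ _)⟩ : Set.Iic i) : ℝ≥0) = r.toNNReal := by
  show min r.toNNReal i = r.toNNReal
  refine min_eq_left ?_
  rw [← NNReal.coe_le_coe, Real.coe_toNNReal _ (ha.trans hr.1.le)]
  exact hr.2.trans hb

/-- ★ **Path integrals of a progressively measurable process are adapted.**  Let `m` be ANY σ-algebra on `Ω` and suppose the restriction
`[0,i] × Ω ∋ (r, ω) ↦ U_r ω` is measurable for `𝓑([0,i]) ⊗ m`.  Then for measurable `φ`, `0 ≤ a` and `b ≤ i` the path integral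
`ω ↦ ∫_(a,b] φ(U_r ω) dr` is `m`-measurable. [folklore] -/
theorem measurable_setIntegral_path {Ω X : Type*} {mΩ : MeasurableSpace Ω} [MeasurableSpace X]
    (i : ℝ≥0) {U : ℝ≥0 → Ω → X} (hprog : Measurable fun q : Set.Iic i × Ω => U q.1 q.2)
    {φ : X → ℝ} (hφ : Measurable φ) {a b : ℝ} (ha : 0 ≤ a) (hb : b ≤ (i : ℝ)) :
    Measurable fun ω => ∫ r in Set.Ioc a b, φ (U r.toNNReal ω) := by
  have hF : Measurable (Function.uncurry fun (ω : Ω) (r : ℝ) =>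
      φ (U ((⟨min r.toNNReal i, Set.mem_Iic.2 (min_le_right _ _)⟩ : Set.Iic i) : ℝ≥0) ω)) :=
    hφ.comp (hprog.comp (((measurable_clampIic i).comp measurable_snd).prodMk measurable_fst))
  have hI := (hF.stronglyMeasurable.integral_prod_right (ν := volume.restrict (Set.Ioc a b))).measurable
  have heq : (fun ω => ∫ r in Set.Ioc a b,
      φ (U ((⟨min r.toNNReal i, Set.mem_Iic.2 (min_le_right _ _)⟩ : Set.Iic i) : ℝ≥0) ω)) =
      fun ω => ∫ r in Set.Ioc a b, φ (U r.toNNReal ω) :=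
    funext fun ω => setIntegral_congr_fun measurableSet_Ioc fun r hr => by rw [clampIic_coe_of_mem ha hb hr]
  rw [← heq]
  exact hI

/-! ## §2. The Markov property for time integrals -/

variable {L : ℕ} [NeZero L]

/-- ★★ **Markov property for time integrals along a strong solution.**  For every realising Markov kernel family `κ` of the SU(2) SZZ dynamics,
every jointly measurable strong solution `U` from a deterministic start `x` on ANY probability space, every `s : ℝ≥0`, `τ ≥ 0`, every bounded
`𝓕^W_s`-measurable `Z` and every continuous bounded `F`:
`∫ Z · (∫_(s,s+τ] F(U_r) dr) dP = ∫ Z · (∫_(0,τ] (∫ F dκ_v(U_s)) dv) dP`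
(file 44 at each time `r`, Fubini on `Ω × (s, s+τ]`, translation `r = s + v`). [folklore] -/
theorem integral_mul_setIntegral_comp_eq_integral_mul_setIntegral_transition (β' : ℝ)
    (κ : ℝ≥0 → Kernel (GaugeConfig 3 L (Matrix.specialUnitaryGroup (Fin 2) ℂ))
      (GaugeConfig 3 L (Matrix.specialUnitaryGroup (Fin 2) ℂ))) [∀ t, IsMarkovKernel (κ t)]
    (hreal : ∀ (t : ℝ≥0) (x : GaugeConfig 3 L (Matrix.specialUnitaryGroup (Fin 2) ℂ))
        (Ω : Type) [MeasurableSpace Ω] (P : Measure Ω) [IsProbabilityMeasure P]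
        (W : ℝ≥0 → Ω → (Edge 3 L × NoiseIdx 2 → ℝ)) (hW : IsFlatBrownian W P)
        (U : ℝ≥0 → Ω → GaugeConfig 3 L (Matrix.specialUnitaryGroup (Fin 2) ℂ)),
        (∀ ω, U 0 ω = x) →
        (latticeLangevinDynamics (fundamentalLatticeRep 2) β').IsSolution (fundamentalRep (Fin 2))
          hW.natFiltration P W U →
        κ t x = P.map (U t))
    (x : GaugeConfig 3 L (Matrix.specialUnitaryGroup (Fin 2) ℂ))
    {Ω : Type} [MeasurableSpace Ω] {P : Measure Ω} [IsProbabilityMeasure P]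
    {W : ℝ≥0 → Ω → (Edge 3 L × NoiseIdx 2 → ℝ)} (hW : IsFlatBrownian W P)
    {U : ℝ≥0 → Ω → GaugeConfig 3 L (Matrix.specialUnitaryGroup (Fin 2) ℂ)} (hU0 : ∀ ω, U 0 ω = x)
    (hU : (latticeLangevinDynamics (fundamentalLatticeRep 2) β').IsSolution (fundamentalRep (Fin 2)) hW.natFiltration P W U)
    (hJ : Measurable fun q : Ω × ℝ => U q.2.toNNReal q.1)
    (s : ℝ≥0) {τ : ℝ} (hτ : 0 ≤ τ) {Z : Ω → ℝ} (hZ : Measurable[hW.natFiltration s] Z) {CZ : ℝ} (hZb : ∀ ω, |Z ω| ≤ CZ)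
    {F : GaugeConfig 3 L (Matrix.specialUnitaryGroup (Fin 2) ℂ) → ℝ} (hF : Continuous F) {CF : ℝ} (hFb : ∀ z, |F z| ≤ CF) :
    ∫ ω, Z ω * (∫ r in Set.Ioc (s : ℝ) (s + τ), F (U r.toNNReal ω)) ∂P =
      ∫ ω, Z ω * (∫ v in Set.Ioc (0 : ℝ) τ, ∫ z, F z ∂(κ v.toNNReal (U s ω))) ∂P := by
  classical
  haveI := secondCountableTopology_su2
  haveI := borelSpace_config L
  have hFm : Measurable F := hF.measurable
  have hZm : Measurable Z := hZ.mono (hW.natFiltration.le s) le_rfl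
  have hmU : ∀ u : ℝ≥0, Measurable (U u) := fun u => (hU.adapted u).mono (hW.natFiltration.le u) le_rfl
  set ν : Measure ℝ := volume.restrict (Set.Ioc (s : ℝ) (s + τ)) with hν
  haveI : IsFiniteMeasure ν := isFiniteMeasure_restrict.2 measure_Ioc_lt_top.ne
  -- the kernel action `g v y = κ_v F(y)`: jointly continuous, bounded by `CF`
  set g : ℝ≥0 → GaugeConfig 3 L (Matrix.specialUnitaryGroup (Fin 2) ℂ) → ℝ := fun v y => ∫ z, F z ∂(κ v y) with hg
  have hgc : Continuous (Function.uncurry g) := continuous_transitionKernel_action β' κ hreal hF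
  have hgm : Measurable (Function.uncurry g) := hgc.measurable
  have hgb : ∀ v y, |g v y| ≤ CF := fun v y => by
    have hh := norm_integral_le_of_norm_le_const (μ := κ v y) (f := F) (C := CF)
      (Eventually.of_forall fun z => by simpa [Real.norm_eq_abs] using hFb z)
    simpa [hg, Real.norm_eq_abs] using hh
  -- (1) Fubini on the left: `E[Z ∫ F(U_r) dr] = ∫ E[Z F(U_r)] dr`
  have hL1 : Measurable (Function.uncurry fun (ω : Ω) (r : ℝ) => Z ω * F (U r.toNNReal ω)) :=
    (hZm.comp measurable_fst).mul (hFm.comp hJ)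
  have hLb : ∀ q : Ω × ℝ, ‖Z q.1 * F (U q.2.toNNReal q.1)‖ ≤ CZ * CF := fun q => by
    rw [norm_mul, Real.norm_eq_abs, Real.norm_eq_abs]
    exact mul_le_mul (hZb _) (hFb _) (abs_nonneg _) ((abs_nonneg _).trans (hZb q.1))
  have hLi : Integrable (Function.uncurry fun (ω : Ω) (r : ℝ) => Z ω * F (U r.toNNReal ω)) (P.prod ν) :=
    (integrable_const (CZ * CF)).mono' hL1.aestronglyMeasurable (Eventually.of_forall fun q => hLb q)
  have hleft : ∫ ω, Z ω * (∫ r in Set.Ioc (s : ℝ) (s + τ), F (U r.toNNReal ω)) ∂P =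
      ∫ r in Set.Ioc (s : ℝ) (s + τ), (∫ ω, Z ω * F (U r.toNNReal ω) ∂P) := by
    have h1 : ∀ ω, Z ω * (∫ r in Set.Ioc (s : ℝ) (s + τ), F (U r.toNNReal ω)) = ∫ r, Z ω * F (U r.toNNReal ω) ∂ν :=
      fun ω => by rw [hν, ← integral_const_mul]
    rw [integral_congr_ae (ae_of_all _ h1), integral_integral_swap hLi]
  -- (2) the Markov property at each time `r ∈ (s, s+τ]`
  have hpt : ∀ r ∈ Set.Ioc (s : ℝ) (s + τ),
      (∫ ω, Z ω * F (U r.toNNReal ω) ∂P) = ∫ ω, Z ω * g (r - s).toNNReal (U s ω) ∂P := by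
    intro r hr
    have hrs : 0 ≤ r - s := sub_nonneg.2 hr.1.le
    have ht : r.toNNReal = s + (r - s).toNNReal := by
      apply NNReal.coe_injective
      rw [NNReal.coe_add, Real.coe_toNNReal _ hrs, Real.coe_toNNReal _ (s.2.trans hr.1.le)]
      ring
    rw [ht]
    exact integral_mul_comp_add_eq_integral_mul_transition β' κ hreal x hW hU0 hU s (r - s).toNNReal hZ hZb hFm hFb
  have hmid : ∫ r in Set.Ioc (s : ℝ) (s + τ), (∫ ω, Z ω * F (U r.toNNReal ω) ∂P) =
      ∫ r in Set.Ioc (s : ℝ) (s + τ), (∫ ω, Z ω * g (r - s).toNNReal (U s ω) ∂P) :=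
    setIntegral_congr_fun measurableSet_Ioc hpt
  -- (3) Fubini back on the right
  have hR1 : Measurable (Function.uncurry fun (ω : Ω) (r : ℝ) => Z ω * g (r - s).toNNReal (U s ω)) :=
    (hZm.comp measurable_fst).mul
      (hgm.comp (((measurable_snd.sub measurable_const).real_toNNReal).prodMk ((hmU s).comp measurable_fst)))
  have hRb : ∀ q : Ω × ℝ, ‖Z q.1 * g (q.2 - s).toNNReal (U s q.1)‖ ≤ CZ * CF := fun q => by
    rw [norm_mul, Real.norm_eq_abs, Real.norm_eq_abs]
    exact mul_le_mul (hZb _) (hgb _ _) (abs_nonneg _) ((abs_nonneg _).trans (hZb q.1))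
  have hRi : Integrable (Function.uncurry fun (ω : Ω) (r : ℝ) => Z ω * g (r - s).toNNReal (U s ω)) (P.prod ν) :=
    (integrable_const (CZ * CF)).mono' hR1.aestronglyMeasurable (Eventually.of_forall fun q => hRb q)
  have hright : ∫ r in Set.Ioc (s : ℝ) (s + τ), (∫ ω, Z ω * g (r - s).toNNReal (U s ω) ∂P) =
      ∫ ω, Z ω * (∫ r in Set.Ioc (s : ℝ) (s + τ), g (r - s).toNNReal (U s ω)) ∂P := by
    have h1 : ∀ ω, Z ω * (∫ r in Set.Ioc (s : ℝ) (s + τ), g (r - s).toNNReal (U s ω)) =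
        ∫ r, Z ω * g (r - s).toNNReal (U s ω) ∂ν := fun ω => by rw [hν, ← integral_const_mul]
    rw [integral_congr_ae (ae_of_all _ h1), integral_integral_swap hRi]
  -- (4) translate `r = s + v`
  have htrans : ∀ ω, (∫ r in Set.Ioc (s : ℝ) (s + τ), g (r - s).toNNReal (U s ω)) =
      ∫ v in Set.Ioc (0 : ℝ) τ, g v.toNNReal (U s ω) := fun ω => by
    rw [← intervalIntegral.integral_of_le (by linarith : (s : ℝ) ≤ s + τ), ← intervalIntegral.integral_of_le hτ,
      intervalIntegral.integral_comp_sub_right (fun v => g v.toNNReal (U s ω)) (s : ℝ)]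
    simp
  rw [hleft, hmid, hright]
  refine integral_congr_ae (ae_of_all _ fun ω => ?_)
  show Z ω * _ = Z ω * _
  rw [htrans ω]

end Summit.QuantumFields.YangMills.Theorems.ColdStartUniversality

end
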